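import Summits.PneNP.PneNP.Theorems.ChebyshevTracialDesignBlockEdgeSwaps
import Mathlib.Data.Nat.Choose.Vandermonde
import HarnessLib

/-!
# Cell pnp-psdrank, route `ChebyshevTracialDesign`: EXCHANGEABILITY of the block edges under the shell measure, II —
# a bivariate small-block mask averages to its hypergeometric mixture on the union block (brick 157b; crux `TracialDecayExp20`,
# stmt-PneNP-19878)

Brick 157b (prover g31; MEMO-33 §5 rev 2 (E)/(S), MEMO-34 §1). Setting of brick 157a (`ChebyshevTracialDesignBlockEdgeSwaps`): a partner
involution `π`, a `π`-stable ground set `S`, and now TWO DISJOINT blocks `H₁, H₂` with no edge of `S` inside `H = H₁ ∪ H₂`,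
`b_i = |S ∩ H_i|`. By the exchangeability of the in-set fibres (157a §3):

* §4 **`choose_mul_card_filter_two_blocks_eq`** —
  `C(b₁+b₂, x₁+x₂)·#{U ∈ Shell_S(t,c) : |U∩H₁| = x₁, |U∩H₂| = x₂} = C(b₁,x₁)·C(b₂,x₂)·#{U ∈ Shell_S(t,c) : |U∩H| = x₁+x₂}`:
  conditionally on `X = |U ∩ H|` the pair `(X₁, X₂)` is HYPERGEOMETRIC, at every level and for every cut size;
* §5 **`sum_shellIn_two_blocks_eq_sum_mixture`** / **`shellInAvg_two_blocks_eq`** — for every bivariate mask `Ψ`,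
  `Σ_{U ∈ Shell_S(t,c)} Ψ(|U∩H₁|,|U∩H₂|) = Σ_{U ∈ Shell_S(t,c)} Ψ̄(|U∩H|)` with the hypergeometric mixture
  `Ψ̄(x) = Σ_{x₁ ≤ b₁, x₂ ≤ b₂, x₁+x₂ = x} C(b₁,x₁)C(b₂,x₂)/C(b₁+b₂,x₁+x₂)·Ψ(x₁,x₂)` — a UNIVARIATE mask of the union block with
  `|Ψ̄| ≤ G` if `|Ψ| ≤ G` and `Ψ̄ ≥ 0` if `Ψ ≥ 0` (`mixture_weights_sum_le_one`, `abs_mixture_le`, `mixture_nonneg`), so that every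
  univariate small-block tool of the cell (T-K2/T-K4b, `ShellLawSmallBlockSmoothness`, brick 151a `piece_abs_le`/`piece_main_le`)
  prices bivariate (product) masks on two small blocks with NO new shell law (MEMO-33 §5 (R)).
WHAT THIS FILE DOES NOT DO: the tilted two-block pieces (brick 158+); anything on `TracialDecayExp20` itself, psd rank of P_PM(K_n),
or P vs NP. [cite: Rothvoss2017, §2 (PDF pp. 5–6)] [cite: GodsilMeagher2015, §15.2]
Stature: support/instrument (kernel lane, no defs, axioms standard). Supports stmt-PneNP-19878.
-/

set_option linter.dupNamespace false -- `Summit.PneNP.PneNP.…`: summit = sub-problem (D-0017)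

noncomputable section

namespace Summit.PneNP.PneNP.Theorems.ChebyshevTracialDesignTwoBlockMixture

open Finset Literature.Combinatorics.Optimization Literature.Combinatorics.Optimization.ShellStep
open Summit.PneNP.PneNP.Theorems.ChebyshevTracialDesignBlockEdgeSwaps (card_filter_inter_eq_eq_of_card_eq)

variable {n : ℕ} {π : Fin n → Fin n}

/-! ### §4 Two disjoint blocks: conditionally on `|U ∩ H|` the pair `(|U∩H₁|, |U∩H₂|)` is hypergeometric -/

section TwoBlocks

variable (hπ : ∀ v, π (π v) = v) (hπ' : ∀ v, π v ≠ v)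
include hπ hπ'

omit hπ hπ' in
/-- The in-set of a cut of `S` lies in `S ∩ H`; the fibres of `U ↦ U ∩ H` over the subsets of `S ∩ H` with a prescribed
property count the cuts whose in-set has the property. [cite: Rothvoss2017, §2 (PDF p. 6)] -/
theorem card_filter_eq_sum_fibre {S H : Finset (Fin n)} (t c : ℕ) (P : Finset (Fin n) → Prop) [DecidablePred P] :
    ((shellIn π S t c).filter fun U => P (U ∩ H)).card =
      ∑ I ∈ (S ∩ H).powerset.filter P, ((shellIn π S t c).filter fun U => U ∩ H = I).card := by
  classical
  have hmaps : ∀ U ∈ (shellIn π S t c).filter (fun U => P (U ∩ H)), U ∩ H ∈ (S ∩ H).powerset.filter P := by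
    intro U hU
    rw [mem_filter] at hU
    rw [mem_filter, mem_powerset]
    exact ⟨inter_subset_inter_right (mem_shellIn.1 hU.1).1, hU.2⟩
  rw [card_eq_sum_card_fiberwise hmaps]
  refine sum_congr rfl fun I hI => ?_
  congr 1
  ext U
  simp only [mem_filter]
  constructor
  · rintro ⟨⟨h1, _⟩, h3⟩; exact ⟨h1, h3⟩
  · rintro ⟨h1, h3⟩; exact ⟨⟨h1, h3 ▸ (mem_filter.1 hI).2⟩, h3⟩

omit hπ hπ' in
/-- Subsets of `S ∩ (H₁ ∪ H₂)` with prescribed traces on the disjoint blocks: `#{I : |I∩H₁| = x₁, |I∩H₂| = x₂} = C(b₁,x₁)·C(b₂,x₂)`.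
[folklore] -/
theorem card_powerset_filter_two_blocks {S H₁ H₂ : Finset (Fin n)} (hdisj : Disjoint H₁ H₂) (x₁ x₂ : ℕ) :
    (((S ∩ (H₁ ∪ H₂)).powerset.filter fun I => (I ∩ H₁).card = x₁ ∧ (I ∩ H₂).card = x₂).card) =
      (S ∩ H₁).card.choose x₁ * (S ∩ H₂).card.choose x₂ := by
  classical
  rw [← card_powersetCard, ← card_powersetCard, ← card_product]
  refine card_nbij' (fun I => (I ∩ H₁, I ∩ H₂)) (fun J => J.1 ∪ J.2) ?_ ?_ ?_ ?_
  · intro I hI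
    rw [mem_coe, mem_filter, mem_powerset] at hI
    obtain ⟨hIS, h1, h2⟩ := hI
    rw [mem_coe, mem_product, mem_powersetCard, mem_powersetCard]
    exact ⟨⟨fun v hv => mem_inter.2 ⟨(mem_inter.1 (hIS (mem_inter.1 hv).1)).1, (mem_inter.1 hv).2⟩, h1⟩,
      ⟨fun v hv => mem_inter.2 ⟨(mem_inter.1 (hIS (mem_inter.1 hv).1)).1, (mem_inter.1 hv).2⟩, h2⟩⟩
  · rintro ⟨J₁, J₂⟩ hJ
    rw [mem_coe, mem_product, mem_powersetCard, mem_powersetCard] at hJ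
    obtain ⟨⟨hJ₁, h1⟩, ⟨hJ₂, h2⟩⟩ := hJ
    have e1 : (J₁ ∪ J₂) ∩ H₁ = J₁ := by
      rw [union_inter_distrib_right, inter_eq_left.2 fun v hv => (mem_inter.1 (hJ₁ hv)).2]
      rw [(disjoint_of_subset_left (fun v hv => (mem_inter.1 (hJ₂ hv)).2) hdisj.symm |> disjoint_iff_inter_eq_empty.1),
        union_empty]
    have e2 : (J₁ ∪ J₂) ∩ H₂ = J₂ := by
      rw [union_inter_distrib_right, inter_eq_left.2 fun v hv => (mem_inter.1 (hJ₂ hv)).2]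
      rw [(disjoint_of_subset_left (fun v hv => (mem_inter.1 (hJ₁ hv)).2) hdisj |> disjoint_iff_inter_eq_empty.1),
        empty_union]
    rw [mem_coe, mem_filter, mem_powerset, e1, e2]
    refine ⟨union_subset (fun v hv => ?_) (fun v hv => ?_), h1, h2⟩
    · exact mem_inter.2 ⟨(mem_inter.1 (hJ₁ hv)).1, mem_union_left _ (mem_inter.1 (hJ₁ hv)).2⟩
    · exact mem_inter.2 ⟨(mem_inter.1 (hJ₂ hv)).1, mem_union_right _ (mem_inter.1 (hJ₂ hv)).2⟩
  · intro I hI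
    rw [mem_coe, mem_filter, mem_powerset] at hI
    show I ∩ H₁ ∪ I ∩ H₂ = I
    rw [← inter_union_distrib_left, inter_eq_left]
    exact fun v hv => (mem_inter.1 (hI.1 hv)).2
  · rintro ⟨J₁, J₂⟩ hJ
    rw [mem_coe, mem_product, mem_powersetCard, mem_powersetCard] at hJ
    obtain ⟨⟨hJ₁, _⟩, ⟨hJ₂, _⟩⟩ := hJ
    show ((J₁ ∪ J₂) ∩ H₁, (J₁ ∪ J₂) ∩ H₂) = (J₁, J₂)
    rw [Prod.mk.injEq, union_inter_distrib_right, union_inter_distrib_right,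
      inter_eq_left.2 fun v hv => (mem_inter.1 (hJ₁ hv)).2, inter_eq_left.2 fun v hv => (mem_inter.1 (hJ₂ hv)).2,
      (disjoint_of_subset_left (fun v hv => (mem_inter.1 (hJ₂ hv)).2) hdisj.symm |> disjoint_iff_inter_eq_empty.1),
      (disjoint_of_subset_left (fun v hv => (mem_inter.1 (hJ₁ hv)).2) hdisj |> disjoint_iff_inter_eq_empty.1),
      union_empty, empty_union]
    exact ⟨rfl, rfl⟩

omit hπ hπ' in
/-- Traces on disjoint blocks add up: `|I ∩ H₁| + |I ∩ H₂| = |I ∩ (H₁ ∪ H₂)|`. [folklore] -/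
theorem card_inter_add_card_inter_eq {H₁ H₂ : Finset (Fin n)} (hdisj : Disjoint H₁ H₂) (I : Finset (Fin n)) :
    (I ∩ H₁).card + (I ∩ H₂).card = (I ∩ (H₁ ∪ H₂)).card := by
  rw [inter_union_distrib_left, card_union_of_disjoint]
  exact disjoint_of_subset_left inter_subset_right (disjoint_of_subset_right inter_subset_right hdisj)

/-- **Conditionally on `X = |U ∩ H|`, `(X₁, X₂) = (|U∩H₁|, |U∩H₂|)` is hypergeometric.** `S` stable, `H₁, H₂` disjoint blocks with no
edge of `S` inside `H = H₁ ∪ H₂`, `b_i = |S ∩ H_i|`: for all `x₁, x₂`,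
`C(b₁+b₂, x₁+x₂)·#{U ∈ Shell_S(t,c) : X₁ = x₁, X₂ = x₂} = C(b₁,x₁)·C(b₂,x₂)·#{U ∈ Shell_S(t,c) : X = x₁+x₂}`.
[cite: Rothvoss2017, §2 (PDF p. 6)] [cite: GodsilMeagher2015, §15.2] -/
theorem choose_mul_card_filter_two_blocks_eq {S H₁ H₂ : Finset (Fin n)} (hS : ∀ v ∈ S, π v ∈ S) (hdisj : Disjoint H₁ H₂)
    (hno : ∀ v ∈ S, ¬ (v ∈ H₁ ∪ H₂ ∧ π v ∈ H₁ ∪ H₂)) (t c x₁ x₂ : ℕ) :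
    ((S ∩ H₁).card + (S ∩ H₂).card).choose (x₁ + x₂) *
        ((shellIn π S t c).filter fun U => (U ∩ H₁).card = x₁ ∧ (U ∩ H₂).card = x₂).card =
      (S ∩ H₁).card.choose x₁ * (S ∩ H₂).card.choose x₂ *
        ((shellIn π S t c).filter fun U => (U ∩ (H₁ ∪ H₂)).card = x₁ + x₂).card := by
  classical
  set H := H₁ ∪ H₂ with hH
  -- a reference in-set of size `x₁ + x₂`, if any
  by_cases hx : x₁ + x₂ ≤ (S ∩ H).card
  swap
  · -- no in-set of that size: both counts vanish
    have hb : (S ∩ H₁).card + (S ∩ H₂).card = (S ∩ H).card := card_inter_add_card_inter_eq hdisj S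
    rw [hb, Nat.choose_eq_zero_of_lt (not_le.1 hx), zero_mul]
    have h0 : ((shellIn π S t c).filter fun U => (U ∩ (H₁ ∪ H₂)).card = x₁ + x₂) = ∅ := by
      rw [filter_eq_empty_iff]
      intro U hU h
      have := card_le_card (inter_subset_inter_right (u := H) (mem_shellIn.1 hU).1)
      rw [← hH] at h; omega
    rw [h0, card_empty, mul_zero]
  obtain ⟨I₀, hI₀⟩ : ∃ I₀ : Finset (Fin n), I₀ ⊆ S ∩ H ∧ I₀.card = x₁ + x₂ := exists_subset_card_eq hx
  set N₀ := ((shellIn π S t c).filter fun U => U ∩ H = I₀).card with hN₀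
  have hconst : ∀ I ∈ (S ∩ H).powerset, I.card = x₁ + x₂ → ((shellIn π S t c).filter fun U => U ∩ H = I).card = N₀ :=
    fun I hI hIc => card_filter_inter_eq_eq_of_card_eq hπ hπ' hS hno t c (mem_powerset.1 hI) hI₀.1 (hIc.trans hI₀.2.symm)
  -- left count
  have hL : ((shellIn π S t c).filter fun U => (U ∩ H₁).card = x₁ ∧ (U ∩ H₂).card = x₂).card =
      (S ∩ H₁).card.choose x₁ * (S ∩ H₂).card.choose x₂ * N₀ := by
    have e : ((shellIn π S t c).filter fun U => (U ∩ H₁).card = x₁ ∧ (U ∩ H₂).card = x₂) =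
        ((shellIn π S t c).filter fun U => (U ∩ H ∩ H₁).card = x₁ ∧ (U ∩ H ∩ H₂).card = x₂) := by
      refine filter_congr fun U _ => ?_
      rw [inter_assoc, inter_assoc, inter_eq_right.2 (subset_union_left (s₂ := H₂)),
        inter_eq_right.2 (subset_union_right (s₁ := H₁))]
    rw [e, card_filter_eq_sum_fibre t c (fun I => (I ∩ H₁).card = x₁ ∧ (I ∩ H₂).card = x₂)]
    rw [sum_congr rfl fun I hI => hconst I (mem_filter.1 hI).1 (by
      have hIH : I ∩ (H₁ ∪ H₂) = I :=
        inter_eq_left.2 ((mem_powerset.1 (mem_filter.1 hI).1).trans inter_subset_right)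
      rw [← hIH, ← card_inter_add_card_inter_eq hdisj I, (mem_filter.1 hI).2.1, (mem_filter.1 hI).2.2]), sum_const,
      smul_eq_mul, card_powerset_filter_two_blocks hdisj]
  -- right count
  have hR : ((shellIn π S t c).filter fun U => (U ∩ (H₁ ∪ H₂)).card = x₁ + x₂).card = (S ∩ H).card.choose (x₁ + x₂) * N₀ := by
    rw [← hH, card_filter_eq_sum_fibre t c (fun I => I.card = x₁ + x₂)]
    rw [sum_congr rfl fun I hI => hconst I (mem_filter.1 hI).1 (mem_filter.1 hI).2, sum_const, smul_eq_mul,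
      ← powersetCard_eq_filter, card_powersetCard]
  rw [hL, hR, card_inter_add_card_inter_eq hdisj S]
  ring

end TwoBlocks

/-! ### §5 The sum form: a bivariate mask averages to its hypergeometric mixture on the union block -/

section Mixture

variable (hπ : ∀ v, π (π v) = v) (hπ' : ∀ v, π v ≠ v)
include hπ hπ'

/-- **`E_{Shell_S(t,c)}[Ψ(X₁,X₂)] = E_{Shell_S(t,c)}[Ψ̄(X)]`** (as sums over the shell): `S` stable, `H₁, H₂` disjoint with no edge of `S`
inside `H₁ ∪ H₂`, `b_i = |S ∩ H_i|`; the hypergeometric mixture is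
`Ψ̄(x) = Σ_{x₁ ≤ b₁, x₂ ≤ b₂, x₁+x₂ = x} C(b₁,x₁)C(b₂,x₂)/C(b₁+b₂,x₁+x₂)·Ψ(x₁,x₂)`.
[cite: Rothvoss2017, §2 (PDF p. 6)] [cite: GodsilMeagher2015, §15.2] -/
theorem sum_shellIn_two_blocks_eq_sum_mixture {S H₁ H₂ : Finset (Fin n)} (hS : ∀ v ∈ S, π v ∈ S) (hdisj : Disjoint H₁ H₂)
    (hno : ∀ v ∈ S, ¬ (v ∈ H₁ ∪ H₂ ∧ π v ∈ H₁ ∪ H₂)) {b₁ b₂ : ℕ} (hb₁ : (S ∩ H₁).card = b₁) (hb₂ : (S ∩ H₂).card = b₂)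
    (t c : ℕ) (Ψ : ℤ → ℤ → ℝ) :
    ∑ U ∈ shellIn π S t c, Ψ ((U ∩ H₁).card : ℤ) ((U ∩ H₂).card : ℤ) =
      ∑ U ∈ shellIn π S t c, ∑ x₁ ∈ range (b₁ + 1), ∑ x₂ ∈ range (b₂ + 1),
        (if x₁ + x₂ = (U ∩ (H₁ ∪ H₂)).card then
          ((b₁.choose x₁ * b₂.choose x₂ : ℕ) : ℝ) / (((b₁ + b₂).choose (x₁ + x₂) : ℕ) : ℝ) else 0) * Ψ x₁ x₂ := by
  classical
  -- left side, sorted by the value of `(X₁, X₂) ∈ [0,b₁] × [0,b₂]`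
  have hmaps : ∀ U ∈ shellIn π S t c, ((U ∩ H₁).card, (U ∩ H₂).card) ∈ range (b₁ + 1) ×ˢ range (b₂ + 1) := by
    intro U hU
    have hUS := (mem_shellIn.1 hU).1
    rw [mem_product, mem_range, mem_range, Nat.lt_succ_iff, Nat.lt_succ_iff, ← hb₁, ← hb₂]
    exact ⟨card_le_card (inter_subset_inter_right hUS), card_le_card (inter_subset_inter_right hUS)⟩
  rw [← sum_fiberwise_of_maps_to hmaps, sum_product]
  -- right side, the two finite sums pulled out
  conv_rhs => rw [sum_comm]; arg 2; ext x₁; rw [sum_comm]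
  refine sum_congr rfl fun x₁ hx₁ => sum_congr rfl fun x₂ hx₂ => ?_
  -- the fibre `{X₁ = x₁, X₂ = x₂}`
  have hfib : ∀ U ∈ (shellIn π S t c).filter (fun U => ((U ∩ H₁).card, (U ∩ H₂).card) = (x₁, x₂)),
      Ψ ((U ∩ H₁).card : ℤ) ((U ∩ H₂).card : ℤ) = Ψ x₁ x₂ := by
    intro U hU
    have h := (mem_filter.1 hU).2
    rw [Prod.mk.injEq] at h
    rw [h.1, h.2]
  rw [sum_congr rfl hfib, sum_const, nsmul_eq_mul]
  simp_rw [ite_mul, zero_mul]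
  rw [← sum_filter, sum_const, nsmul_eq_mul]
  have e1 : ((shellIn π S t c).filter fun U => ((U ∩ H₁).card, (U ∩ H₂).card) = (x₁, x₂)) =
      ((shellIn π S t c).filter fun U => (U ∩ H₁).card = x₁ ∧ (U ∩ H₂).card = x₂) :=
    filter_congr fun U _ => by rw [Prod.mk.injEq]
  have e2 : ((shellIn π S t c).filter fun U => x₁ + x₂ = (U ∩ (H₁ ∪ H₂)).card) =
      ((shellIn π S t c).filter fun U => (U ∩ (H₁ ∪ H₂)).card = x₁ + x₂) :=
    filter_congr fun U _ => eq_comm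
  rw [e1, e2]
  have key := choose_mul_card_filter_two_blocks_eq hπ hπ' hS hdisj hno t c x₁ x₂
  rw [hb₁, hb₂] at key
  have hpos : (0 : ℝ) < (((b₁ + b₂).choose (x₁ + x₂) : ℕ) : ℝ) := by
    rw [mem_range, Nat.lt_succ_iff] at hx₁ hx₂
    exact_mod_cast Nat.choose_pos (by omega)
  have key' : (((b₁ + b₂).choose (x₁ + x₂) : ℕ) : ℝ) *
      (((shellIn π S t c).filter fun U => (U ∩ H₁).card = x₁ ∧ (U ∩ H₂).card = x₂).card : ℝ) =
      ((b₁.choose x₁ * b₂.choose x₂ : ℕ) : ℝ) *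
        (((shellIn π S t c).filter fun U => (U ∩ (H₁ ∪ H₂)).card = x₁ + x₂).card : ℝ) := by
    exact_mod_cast key
  have hA : (((shellIn π S t c).filter fun U => (U ∩ H₁).card = x₁ ∧ (U ∩ H₂).card = x₂).card : ℝ) =
      ((b₁.choose x₁ * b₂.choose x₂ : ℕ) : ℝ) / (((b₁ + b₂).choose (x₁ + x₂) : ℕ) : ℝ) *
        (((shellIn π S t c).filter fun U => (U ∩ (H₁ ∪ H₂)).card = x₁ + x₂).card : ℝ) := by
    rw [div_mul_eq_mul_div, eq_div_iff hpos.ne', mul_comm]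
    exact key'
  rw [hA]
  ring

omit hπ hπ' in
/-- **The mixture weights sum to at most one** (`= 1` by Vandermonde when `x ≤ b₁ + b₂`, `= 0` beyond):
`Σ_{x₁ ≤ b₁, x₂ ≤ b₂, x₁+x₂ = x} C(b₁,x₁)C(b₂,x₂)/C(b₁+b₂,x₁+x₂) ≤ 1`. [folklore] -/
theorem mixture_weights_sum_le_one (b₁ b₂ : ℕ) (x : ℤ) :
    ∑ x₁ ∈ range (b₁ + 1), ∑ x₂ ∈ range (b₂ + 1),
        (if ((x₁ + x₂ : ℕ) : ℤ) = x then ((b₁.choose x₁ * b₂.choose x₂ : ℕ) : ℝ) / (((b₁ + b₂).choose (x₁ + x₂) : ℕ) : ℝ)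
          else 0) ≤ 1 := by
  classical
  -- reduce to a natural level `x = k ≤ b₁ + b₂`; otherwise every term vanishes
  by_cases hk : ∃ k : ℕ, (k : ℤ) = x ∧ k ≤ b₁ + b₂
  swap
  · have h0 : ∀ x₁ x₂ : ℕ, (if ((x₁ + x₂ : ℕ) : ℤ) = x then
        ((b₁.choose x₁ * b₂.choose x₂ : ℕ) : ℝ) / (((b₁ + b₂).choose (x₁ + x₂) : ℕ) : ℝ) else 0) ≤ 0 := by
      intro x₁ x₂
      split_ifs with h
      · by_cases hle : x₁ + x₂ ≤ b₁ + b₂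
        · exact absurd ⟨x₁ + x₂, h, hle⟩ hk
        · rw [Nat.choose_eq_zero_of_lt (not_le.1 hle), Nat.cast_zero, div_zero]
      · exact le_rfl
    calc _ ≤ ∑ x₁ ∈ range (b₁ + 1), ∑ x₂ ∈ range (b₂ + 1), (0 : ℝ) :=
          sum_le_sum fun x₁ _ => sum_le_sum fun x₂ _ => h0 x₁ x₂
      _ ≤ 1 := by simp
  obtain ⟨k, rfl, hkb⟩ := hk
  have hpos : (0 : ℝ) < (((b₁ + b₂).choose k : ℕ) : ℝ) := by exact_mod_cast Nat.choose_pos hkb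
  -- the terms with `x₁ + x₂ = k`, as a sum over the antidiagonal
  have hV : (((b₁ + b₂).choose k : ℕ) : ℝ) = ∑ ij ∈ antidiagonal k, ((b₁.choose ij.1 * b₂.choose ij.2 : ℕ) : ℝ) := by
    rw [Nat.add_choose_eq]; push_cast; rfl
  calc ∑ x₁ ∈ range (b₁ + 1), ∑ x₂ ∈ range (b₂ + 1),
        (if ((x₁ + x₂ : ℕ) : ℤ) = (k : ℤ) then ((b₁.choose x₁ * b₂.choose x₂ : ℕ) : ℝ) / (((b₁ + b₂).choose (x₁ + x₂) : ℕ) : ℝ)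
          else 0)
      = ∑ p ∈ range (b₁ + 1) ×ˢ range (b₂ + 1),
          (if p.1 + p.2 = k then ((b₁.choose p.1 * b₂.choose p.2 : ℕ) : ℝ) / (((b₁ + b₂).choose k : ℕ) : ℝ) else 0) := by
        rw [sum_product]
        refine sum_congr rfl fun x₁ _ => sum_congr rfl fun x₂ _ => ?_
        split_ifs with h1 h2 h2
        · rw [h2]
        · exact absurd (by exact_mod_cast h1) h2
        · exact absurd (by exact_mod_cast h2) h1
        · rfl
    _ = ∑ p ∈ (range (b₁ + 1) ×ˢ range (b₂ + 1)).filter (fun p => p.1 + p.2 = k),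
          ((b₁.choose p.1 * b₂.choose p.2 : ℕ) : ℝ) / (((b₁ + b₂).choose k : ℕ) : ℝ) := by rw [sum_filter]
    _ ≤ ∑ p ∈ antidiagonal k, ((b₁.choose p.1 * b₂.choose p.2 : ℕ) : ℝ) / (((b₁ + b₂).choose k : ℕ) : ℝ) := by
        refine sum_le_sum_of_subset_of_nonneg (fun p hp => ?_) (fun p _ _ => by positivity)
        rw [mem_filter] at hp
        rw [Finset.HasAntidiagonal.mem_antidiagonal]; exact hp.2
    _ = 1 := by rw [← sum_div, ← hV, div_self hpos.ne']

omit hπ hπ' in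
/-- A doubly indexed average with nonnegative weights of total mass `≤ 1` of values bounded by `G` is bounded by `G`. [folklore] -/
theorem abs_sum_sum_mul_le {s₁ s₂ : Finset ℕ} (w Ψ : ℕ → ℕ → ℝ) (hw : ∀ x₁ x₂, 0 ≤ w x₁ x₂)
    (hsum : ∑ x₁ ∈ s₁, ∑ x₂ ∈ s₂, w x₁ x₂ ≤ 1) {G : ℝ} (hG0 : 0 ≤ G) (hG : ∀ x₁ ∈ s₁, ∀ x₂ ∈ s₂, |Ψ x₁ x₂| ≤ G) :
    |∑ x₁ ∈ s₁, ∑ x₂ ∈ s₂, w x₁ x₂ * Ψ x₁ x₂| ≤ G := by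
  calc |∑ x₁ ∈ s₁, ∑ x₂ ∈ s₂, w x₁ x₂ * Ψ x₁ x₂| ≤ ∑ x₁ ∈ s₁, |∑ x₂ ∈ s₂, w x₁ x₂ * Ψ x₁ x₂| := abs_sum_le_sum_abs _ _
    _ ≤ ∑ x₁ ∈ s₁, ∑ x₂ ∈ s₂, |w x₁ x₂ * Ψ x₁ x₂| := sum_le_sum fun x₁ _ => abs_sum_le_sum_abs _ _
    _ ≤ ∑ x₁ ∈ s₁, ∑ x₂ ∈ s₂, w x₁ x₂ * G := by
        refine sum_le_sum fun x₁ hx₁ => sum_le_sum fun x₂ hx₂ => ?_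
        rw [abs_mul, abs_of_nonneg (hw x₁ x₂)]
        exact mul_le_mul_of_nonneg_left (hG x₁ hx₁ x₂ hx₂) (hw x₁ x₂)
    _ = (∑ x₁ ∈ s₁, ∑ x₂ ∈ s₂, w x₁ x₂) * G := by rw [sum_mul]; simp_rw [sum_mul]
    _ ≤ 1 * G := mul_le_mul_of_nonneg_right hsum hG0
    _ = G := one_mul G

omit hπ hπ' in
/-- **The mixture of a bounded mask is bounded**: if `|Ψ(x₁,x₂)| ≤ G` on `[0,b₁] × [0,b₂]` then `|Ψ̄(x)| ≤ G` for every `x`.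
[folklore] -/
theorem abs_mixture_le (b₁ b₂ : ℕ) (Ψ : ℤ → ℤ → ℝ) {G : ℝ}
    (hG : ∀ x₁ ∈ range (b₁ + 1), ∀ x₂ ∈ range (b₂ + 1), |Ψ x₁ x₂| ≤ G) (x : ℤ) :
    |∑ x₁ ∈ range (b₁ + 1), ∑ x₂ ∈ range (b₂ + 1),
        (if ((x₁ + x₂ : ℕ) : ℤ) = x then ((b₁.choose x₁ * b₂.choose x₂ : ℕ) : ℝ) / (((b₁ + b₂).choose (x₁ + x₂) : ℕ) : ℝ)
          else 0) * Ψ x₁ x₂| ≤ G := by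
  have hG0 : 0 ≤ G := (abs_nonneg _).trans (hG 0 (by simp) 0 (by simp))
  exact abs_sum_sum_mul_le (fun x₁ x₂ => if ((x₁ + x₂ : ℕ) : ℤ) = x then
      ((b₁.choose x₁ * b₂.choose x₂ : ℕ) : ℝ) / (((b₁ + b₂).choose (x₁ + x₂) : ℕ) : ℝ) else 0) (fun x₁ x₂ => Ψ x₁ x₂)
    (fun x₁ x₂ => by split_ifs <;> positivity) (mixture_weights_sum_le_one b₁ b₂ x) hG0 hG

omit hπ hπ' in
/-- **The mixture of a nonnegative mask is nonnegative.** [folklore] -/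
theorem mixture_nonneg (b₁ b₂ : ℕ) (Ψ : ℤ → ℤ → ℝ)
    (h0 : ∀ x₁ ∈ range (b₁ + 1), ∀ x₂ ∈ range (b₂ + 1), 0 ≤ Ψ x₁ x₂) (x : ℤ) :
    0 ≤ ∑ x₁ ∈ range (b₁ + 1), ∑ x₂ ∈ range (b₂ + 1),
        (if ((x₁ + x₂ : ℕ) : ℤ) = x then ((b₁.choose x₁ * b₂.choose x₂ : ℕ) : ℝ) / (((b₁ + b₂).choose (x₁ + x₂) : ℕ) : ℝ)
          else 0) * Ψ x₁ x₂ :=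
  sum_nonneg fun x₁ hx₁ => sum_nonneg fun x₂ hx₂ => mul_nonneg (by split_ifs <;> positivity) (h0 x₁ hx₁ x₂ hx₂)

/-- **Average form**: the shell AVERAGE of a bivariate mask is the shell average of its mixture (the common normalisation
`|Shell_S(t,c)|` divides both sides of `sum_shellIn_two_blocks_eq_sum_mixture`). [cite: Rothvoss2017, §2 (PDF p. 6)] -/
theorem shellInAvg_two_blocks_eq {S H₁ H₂ : Finset (Fin n)} (hS : ∀ v ∈ S, π v ∈ S) (hdisj : Disjoint H₁ H₂)
    (hno : ∀ v ∈ S, ¬ (v ∈ H₁ ∪ H₂ ∧ π v ∈ H₁ ∪ H₂)) {b₁ b₂ : ℕ} (hb₁ : (S ∩ H₁).card = b₁) (hb₂ : (S ∩ H₂).card = b₂)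
    (t c : ℕ) (Ψ : ℤ → ℤ → ℝ) :
    (∑ U ∈ shellIn π S t c, Ψ ((U ∩ H₁).card : ℤ) ((U ∩ H₂).card : ℤ)) / ((shellIn π S t c).card : ℝ) =
      (∑ U ∈ shellIn π S t c, ∑ x₁ ∈ range (b₁ + 1), ∑ x₂ ∈ range (b₂ + 1),
        (if ((x₁ + x₂ : ℕ) : ℤ) = ((U ∩ (H₁ ∪ H₂)).card : ℤ) then
          ((b₁.choose x₁ * b₂.choose x₂ : ℕ) : ℝ) / (((b₁ + b₂).choose (x₁ + x₂) : ℕ) : ℝ) else 0) * Ψ x₁ x₂) /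
        ((shellIn π S t c).card : ℝ) := by
  rw [sum_shellIn_two_blocks_eq_sum_mixture hπ hπ' hS hdisj hno hb₁ hb₂ t c Ψ]
  congr 1
  refine sum_congr rfl fun U _ => sum_congr rfl fun x₁ _ => sum_congr rfl fun x₂ _ => ?_
  simp only [Nat.cast_inj]

omit hπ hπ' in
/-- **The mixture weights sum to exactly one on the genuine levels** (`x ≤ b₁ + b₂`; Vandermonde):
`Σ_{x₁ ≤ b₁, x₂ ≤ b₂, x₁+x₂ = x} C(b₁,x₁)C(b₂,x₂)/C(b₁+b₂,x₁+x₂) = 1` — so the mixture of the constant mask `1` is `1` on `[0, b₁+b₂]`,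
and the mixture is a genuine average there (v2 addendum). [folklore] -/
theorem mixture_weights_sum_eq_one (b₁ b₂ : ℕ) {k : ℕ} (hk : k ≤ b₁ + b₂) :
    ∑ x₁ ∈ range (b₁ + 1), ∑ x₂ ∈ range (b₂ + 1),
        (if ((x₁ + x₂ : ℕ) : ℤ) = (k : ℤ) then ((b₁.choose x₁ * b₂.choose x₂ : ℕ) : ℝ) / (((b₁ + b₂).choose (x₁ + x₂) : ℕ) : ℝ)
          else 0) = 1 := by
  classical
  have hpos : (0 : ℝ) < (((b₁ + b₂).choose k : ℕ) : ℝ) := by exact_mod_cast Nat.choose_pos hk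
  have hV : (((b₁ + b₂).choose k : ℕ) : ℝ) = ∑ ij ∈ antidiagonal k, ((b₁.choose ij.1 * b₂.choose ij.2 : ℕ) : ℝ) := by
    rw [Nat.add_choose_eq]; push_cast; rfl
  calc ∑ x₁ ∈ range (b₁ + 1), ∑ x₂ ∈ range (b₂ + 1),
        (if ((x₁ + x₂ : ℕ) : ℤ) = (k : ℤ) then ((b₁.choose x₁ * b₂.choose x₂ : ℕ) : ℝ) / (((b₁ + b₂).choose (x₁ + x₂) : ℕ) : ℝ)
          else 0)
      = ∑ p ∈ range (b₁ + 1) ×ˢ range (b₂ + 1),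
          (if p.1 + p.2 = k then ((b₁.choose p.1 * b₂.choose p.2 : ℕ) : ℝ) / (((b₁ + b₂).choose k : ℕ) : ℝ) else 0) := by
        rw [sum_product]
        refine sum_congr rfl fun x₁ _ => sum_congr rfl fun x₂ _ => ?_
        split_ifs with h1 h2 h2
        · rw [h2]
        · exact absurd (by exact_mod_cast h1) h2
        · exact absurd (by exact_mod_cast h2) h1
        · rfl
    _ = ∑ p ∈ (range (b₁ + 1) ×ˢ range (b₂ + 1)).filter (fun p => p.1 + p.2 = k),
          ((b₁.choose p.1 * b₂.choose p.2 : ℕ) : ℝ) / (((b₁ + b₂).choose k : ℕ) : ℝ) := by rw [sum_filter]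
    _ = ∑ p ∈ antidiagonal k, ((b₁.choose p.1 * b₂.choose p.2 : ℕ) : ℝ) / (((b₁ + b₂).choose k : ℕ) : ℝ) := by
        -- the terms of the antidiagonal outside the box vanish (`C(b_i, x_i) = 0` for `x_i > b_i`)
        refine sum_subset (fun p hp => ?_) (fun p hp hnp => ?_)
        · rw [mem_filter] at hp
          rw [Finset.HasAntidiagonal.mem_antidiagonal]; exact hp.2
        · rw [Finset.HasAntidiagonal.mem_antidiagonal] at hp
          rw [mem_filter, mem_product, mem_range, mem_range, not_and_or] at hnp
          rcases hnp with h | h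
          · rcases not_and_or.1 h with h1 | h1
            · rw [Nat.choose_eq_zero_of_lt (by omega : b₁ < p.1)]; simp
            · rw [Nat.choose_eq_zero_of_lt (by omega : b₂ < p.2)]; simp
          · exact absurd hp h
    _ = 1 := by rw [← sum_div, ← hV, div_self hpos.ne']

end Mixture

end Summit.PneNP.PneNP.Theorems.ChebyshevTracialDesignTwoBlockMixture

end
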